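import Summits.Ventures.YMGap.RobustBall.CouplingDerivativeOnBallS
import Summits.Ventures.YMGap.RobustBall.StateSecondDerivativeS
import HarnessLib

/-!
# Venture YMGap, track ROBUST-BALL (Y2) — TIER 2: EVERY MEMBER OF THE WEIGHTED BALL IS `C²` IN THE COUPLING, WITH SECOND DERIVATIVE THE DOUBLE
# PLAQUETTE-CUMULANT SERIES; `SU(2)`, `ℤ⁴` CELLS OF THE `C²` STATEMENTS

HONEST FRAMING. WHAT THIS IS: a venture file (cell `pub-ymgap`, track Y2 ROBUST-BALL, seat rb-p1, theorems only): the coupling instance and the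
hypothesis-free `SU(2)`, `ℤ⁴` cells of `StateSecondDerivativeS` (the state is `C²` along every direction of finite size-weighted load).  The Wilson part
of the energy is a direction of the ball (`CouplingDerivativeOnBallS.wilsonDirection`, `𝒢_{β}(W + κ•wilsonDirection) = 𝒢_{β+κ}(W)`) whose link sets
are plaquette boundaries (`≤ 4` links), so its size-weighted Lipschitz load is at most `4×` its Lipschitz load `8(d−1)√N|κ|`:
* ★★★ `contDiffOn_two_integral_coupling_S` — member `W ∈ MemBallZdS a Λ t` in the pair door `ρ' < 1` at `(a', Λ', t)` with room
  `a + s₀·4(d−1)N|κ| ≤ a'`, `Λ + s₀·8(d−1)√N e^{t}|κ| ≤ Λ'`, `t > 0`; `ν(s) ∈ 𝒢_{Nβ+sκ}(W)` ANY selection on `|s| ≤ s₀`; `F` bounded measurable local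
  Frobenius-Lipschitz.  Then (i) at every `|s| < s₀` the plaquette-susceptibility series `s ↦ Σ'_X cov_{ν(s)}(F, (κ•wilsonDirection)_X)` has derivative
  `−Σ'_{(X,Y)} u₃^{ν(s)}(F; (κ•wD)_X; (κ•wD)_Y)`, (ii) that double cumulant series is continuous on `|s| ≤ s₀`, (iii) `s ↦ ⟨F⟩_{ν(s)}` is `ContDiffOn ℝ 2`
  on `(−s₀, s₀)`: EVERY MEMBER OF THE TIER-2 BALL IS `C²` IN THE COUPLING, `d²⟨F⟩/dβ²` = the absolutely convergent double plaquette-cumulant series;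
* `su2_contDiffOn_two_integral_direction_dim4` — `SU(2)`, `ℤ⁴`, directions: `6|β_W| e^{a'} e^{t} + e^{a'/2} √(2/3) Λ' < 1`, direction loads `(L, L₂)` ⇒
  (i) + `ContDiffOn ℝ 2` along the line, for every Lipschitz cylinder;
* `su2_contDiffOn_two_integral_coupling_dim4` — `SU(2)`, `ℤ⁴`, coupling `β_W`: `a + 12 s₀ ≤ a'`, `Λ + 12√2 e^{t} s₀ ≤ Λ'` ⇒ `β_W ↦ ⟨F⟩` is
  `ContDiffOn ℝ 2` on `(β_W − s₀, β_W + s₀)` (as a function of the shift), every member `W`, every Lipschitz cylinder `F`.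
WHAT THIS IS NOT: `C³` or analyticity in `β` — for the PURE Wilson action the cell already holds `C²` with the same second-derivative formula
(`Thresholds/CouplingSecondDerivative(SUN)`, ds-1) and analyticity (`Thresholds/StrongCouplingAnalytic*`); the point here is EVERY MEMBER `W` OF THE
BALL (an arbitrary summable multi-link perturbation in the pair door), two derivatives, directly in infinite volume; one-sided Dobrushin-comparison
constants at lattice strong coupling; nothing about the continuum limit or a Clay-sense mass gap.
-/

noncomputable section

open MeasureTheory Function Finset ProbabilityTheory Real Filter Topology
open scoped NNReal
open Literature.Probability.LatticeModels
open Literature.Probability.LatticeModels.DobrushinMetric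
open Literature.MathematicalPhysics.QuantumLattice
open Literature.MathematicalPhysics.QuantumFieldTheory hiding ZdEdge
open Summit.QuantumFields.BalabanUV.InfraRed.StrongCouplingPoincareDoorSUN (oneLinkPoincareSUN_two_sharp)

namespace Summit.Ventures.YMGap.RobustBall

variable {d N : ℕ}

/-! ### The coupling direction: `C²` in `β` -/

section Coupling

variable {W : Potential (ZdEdge d) (Matrix.specialUnitaryGroup (Fin N) ℂ)}

/-- ★★★ **EVERY MEMBER OF THE WEIGHTED BALL IS `C²` IN THE COUPLING.**  Member `W ∈ MemBallZdS a Λ t` inside the pair door `ρ' < 1` at `(a', Λ', t)`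
with room `a + s₀·4(d−1)N|κ| ≤ a'`, `Λ + s₀·8(d−1)√N e^{t}|κ| ≤ Λ'`, `t > 0`; `ν(s) ∈ 𝒢_{Nβ + sκ}(W)` any selection on `|s| ≤ s₀`; `F` bounded
measurable local Frobenius-Lipschitz.  Then (i) at every `|s| < s₀`:
`HasDerivAt (s ↦ Σ'_X cov_{ν(s)}(F, (κ•wD)_X)) (−Σ'_{(X,Y)} u₃^{ν(s)}(F; (κ•wD)_X; (κ•wD)_Y)) s` (`wD = wilsonDirection`); (ii) the double cumulant
series is continuous on `|s| ≤ s₀`; (iii) `s ↦ ∫ F dν(s)` is `ContDiffOn ℝ 2` on `(−s₀, s₀)`. -/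
theorem contDiffOn_two_integral_coupling_S (hd : 1 ≤ d) (hN : 1 ≤ N) {β b c v a' Λ' t : ℝ}
    (hc : 0 ≤ c) (hv : 0 ≤ v) (hb : |β| * (2 * ((d : ℝ) - 1)) ≤ b)
    (hP : ∀ B : Matrix (Fin N) (Fin N) ℂ, matrixOpNorm B ≤ b →
      ∀ (ψ : Matrix.specialUnitaryGroup (Fin N) ℂ → ℝ) (M : ℝ), 0 ≤ M →
        (∀ x y, |ψ x - ψ y| ≤ M * suFrobDist x y) →
        Var[ψ; (haarProbability (Matrix.specialUnitaryGroup (Fin N) ℂ)).tilted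
          fun g => (N : ℝ) * ((g : Matrix (Fin N) (Fin N) ℂ) * B).trace.re] ≤ c * M ^ 2)
    (hVB : ∀ B : Matrix (Fin N) (Fin N) ℂ, matrixOpNorm B ≤ b → ∀ Δ : Matrix (Fin N) (Fin N) ℂ,
      Var[fun g : Matrix.specialUnitaryGroup (Fin N) ℂ =>
          (N : ℝ) * ((g : Matrix (Fin N) (Fin N) ℂ) * Δ).trace.re;
        (haarProbability (Matrix.specialUnitaryGroup (Fin N) ℂ)).tilted
          fun g => (N : ℝ) * ((g : Matrix (Fin N) (Fin N) ℂ) * B).trace.re] ≤ v * frobNorm Δ ^ 2)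
    (ht : 0 < t) (hρ : 6 * ((d : ℝ) - 1) * |β| * (exp a' * exp t * Real.sqrt (c * v)) + exp (a' / 2) * Real.sqrt c * Λ' < 1)
    {a Λ s₀ κ : ℝ} (hW : MemBallZdS a Λ t W) (hs₀ : 0 < s₀)
    (ha' : a + s₀ * (|κ| * (4 * ((d : ℝ) - 1) * N)) ≤ a') (hΛ' : Λ + s₀ * (|κ| * (exp t * (8 * ((d : ℝ) - 1) * Real.sqrt N))) ≤ Λ')
    {ν : ℝ → Measure (LGConfig d (Matrix.specialUnitaryGroup (Fin N) ℂ))}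
    (hν : ∀ s ∈ Set.Icc (-s₀) s₀, ν s ∈ perturbedGibbsMeasuresS (d := d) (fundamentalRep (Fin N)) (N * β + s * κ) W)
    {F : LGConfig d (Matrix.specialUnitaryGroup (Fin N) ℂ) → ℝ} (hFm : Measurable F) {ΛF : Finset (ZdEdge d)}
    (hFdep : DependsOn F (↑ΛF : Set (ZdEdge d))) {MF : ℝ} (hMF : ∀ σ, |F σ| ≤ MF) {δF : ZdEdge d → ℝ}
    (hδF : IsLipBound suFrobDist F δF) :
    (∀ s ∈ Set.Ioo (-s₀) s₀, HasDerivAt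
      (fun s => ∑' X : Finset (ZdEdge d), cov[F, (κ • (wilsonDirection : Potential (ZdEdge d) (Matrix.specialUnitaryGroup (Fin N) ℂ))) X; ν s])
      (-(∑' p : Finset (ZdEdge d) × Finset (ZdEdge d),
        (cov[fun U => F U * (κ • (wilsonDirection : Potential (ZdEdge d) (Matrix.specialUnitaryGroup (Fin N) ℂ))) p.1 U,
            (κ • (wilsonDirection : Potential (ZdEdge d) (Matrix.specialUnitaryGroup (Fin N) ℂ))) p.2; ν s] -
          (∫ U, F U ∂(ν s)) * cov[(κ • (wilsonDirection : Potential (ZdEdge d) (Matrix.specialUnitaryGroup (Fin N) ℂ))) p.1,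
            (κ • (wilsonDirection : Potential (ZdEdge d) (Matrix.specialUnitaryGroup (Fin N) ℂ))) p.2; ν s] -
          (∫ U, (κ • (wilsonDirection : Potential (ZdEdge d) (Matrix.specialUnitaryGroup (Fin N) ℂ))) p.1 U ∂(ν s)) *
            cov[F, (κ • (wilsonDirection : Potential (ZdEdge d) (Matrix.specialUnitaryGroup (Fin N) ℂ))) p.2; ν s]))) s) ∧
    ContinuousOn (fun s => ∑' p : Finset (ZdEdge d) × Finset (ZdEdge d),
        (cov[fun U => F U * (κ • (wilsonDirection : Potential (ZdEdge d) (Matrix.specialUnitaryGroup (Fin N) ℂ))) p.1 U,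
            (κ • (wilsonDirection : Potential (ZdEdge d) (Matrix.specialUnitaryGroup (Fin N) ℂ))) p.2; ν s] -
          (∫ U, F U ∂(ν s)) * cov[(κ • (wilsonDirection : Potential (ZdEdge d) (Matrix.specialUnitaryGroup (Fin N) ℂ))) p.1,
            (κ • (wilsonDirection : Potential (ZdEdge d) (Matrix.specialUnitaryGroup (Fin N) ℂ))) p.2; ν s] -
          (∫ U, (κ • (wilsonDirection : Potential (ZdEdge d) (Matrix.specialUnitaryGroup (Fin N) ℂ))) p.1 U ∂(ν s)) *
            cov[F, (κ • (wilsonDirection : Potential (ZdEdge d) (Matrix.specialUnitaryGroup (Fin N) ℂ))) p.2; ν s])) (Set.Icc (-s₀) s₀) ∧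
    ContDiffOn ℝ 2 (fun s => ∫ U, F U ∂(ν s)) (Set.Ioo (-s₀) s₀) := by
  classical
  obtain ⟨BW, hBW⟩ := hW.summable
  obtain ⟨P, hPdef⟩ : ∃ P : Potential (ZdEdge d) (Matrix.specialUnitaryGroup (Fin N) ℂ), P = wilsonDirection := ⟨_, rfl⟩
  rw [← hPdef]
  have hV : MemBallZdS (|κ| * (4 * ((d : ℝ) - 1) * N)) (|κ| * (exp t * (8 * ((d : ℝ) - 1) * Real.sqrt N))) t (κ • P) :=
    hPdef ▸ (memBallZdS_wilsonDirection (N := N) hd ht.le).smul κ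
  have hd1 : (0 : ℝ) ≤ (d : ℝ) - 1 := by
    have : (1 : ℝ) ≤ d := by exact_mod_cast hd
    linarith
  have haV : 0 ≤ |κ| * (4 * ((d : ℝ) - 1) * N) := by positivity
  have hΛV : 0 ≤ |κ| * (exp t * (8 * ((d : ℝ) - 1) * Real.sqrt N)) := by positivity
  -- the line `W + s·(κ·P)` at coupling `Nβ` IS the member at coupling `Nβ + sκ`
  have hν' : ∀ s ∈ Set.Icc (-s₀) s₀, ν s ∈ perturbedGibbsMeasuresS (d := d) (fundamentalRep (Fin N)) (N * β) (W + s • (κ • P)) :=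
    fun s hs => by
      rw [smul_smul, hPdef, perturbedGibbsMeasuresS_add_smul_wilsonDirection hBW]; exact hν s hs
  -- Lipschitz witnesses of `κ·P`, their total load and their size-weighted load (plaquette sets have at most four links)
  obtain ⟨lipV, hlipV⟩ : ∃ lipV : Finset (ZdEdge d) → ZdEdge d → ℝ, lipV = fun X y =>
      |κ| * (if (∃ p : ZdPlaquette d, plaquetteEdges p = X) then (if y ∈ X then Real.sqrt N else 0) else 0) := ⟨_, rfl⟩
  have hlip : ∀ X, IsLipBound suFrobDist ((κ • P) X) (lipV X) := fun X => by
    rw [hlipV, hPdef]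
    exact isLipBound_smul (isLipBound_wilsonDirection_supp (N := N) X) κ
  have hload := fun e => lipLoad_wilsonDirection (N := N) hd e
  have hfun : ∀ e : ZdEdge d, (fun X : Finset (ZdEdge d) => (if e ∈ X then ∑ y ∈ X, lipV X y else 0)) =
      fun X => |κ| * (if e ∈ X then ∑ y ∈ X,
        (if (∃ p : ZdPlaquette d, plaquetteEdges p = X) then (if y ∈ X then Real.sqrt (N : ℝ) else 0) else 0) else 0) := fun e => by
    funext X; simp only [hlipV, ← Finset.mul_sum]; split_ifs <;> simp
  have hLs : ∀ e, Summable fun X : Finset (ZdEdge d) => (if e ∈ X then ∑ y ∈ X, lipV X y else 0) := fun e => by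
    rw [hfun e]; exact ((hload e).1).mul_left |κ|
  have hL : ∀ e, ∑' X : Finset (ZdEdge d), (if e ∈ X then ∑ y ∈ X, lipV X y else 0) ≤ |κ| * (8 * ((d : ℝ) - 1) * Real.sqrt N) :=
    fun e => by
      rw [hfun e, tsum_mul_left]
      exact mul_le_mul_of_nonneg_left (hload e).2 (abs_nonneg κ)
  have hcmp : ∀ (e : ZdEdge d) (X : Finset (ZdEdge d)),
      (if e ∈ X then (X.card : ℝ) * ∑ y ∈ X, lipV X y else 0) ≤ 4 * (if e ∈ X then ∑ y ∈ X, lipV X y else 0) := by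
    intro e X
    split_ifs with he
    · by_cases hX : ∃ p : ZdPlaquette d, plaquetteEdges p = X
      · obtain ⟨p, rfl⟩ := hX
        have h4 : ((plaquetteEdges p).card : ℝ) ≤ 4 := by exact_mod_cast card_plaquetteEdges_le p
        exact mul_le_mul_of_nonneg_right h4 (sum_nonneg fun y _ => (hlip _).nonneg y)
      · have h0 : ∑ y ∈ X, lipV X y = 0 := sum_eq_zero fun y _ => by simp only [hlipV, if_neg hX, mul_zero]
        rw [h0, mul_zero, mul_zero]
    · rw [mul_zero]
  have hnn : ∀ (e : ZdEdge d) (X : Finset (ZdEdge d)), 0 ≤ (if e ∈ X then (X.card : ℝ) * ∑ y ∈ X, lipV X y else 0) := fun e X => by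
    split_ifs
    exacts [mul_nonneg (Nat.cast_nonneg _) (sum_nonneg fun y _ => (hlip X).nonneg y), le_rfl]
  have hLs4 : ∀ e, Summable fun X : Finset (ZdEdge d) => 4 * (if e ∈ X then ∑ y ∈ X, lipV X y else 0) := fun e => (hLs e).mul_left 4
  have hL2s : ∀ e, Summable fun X : Finset (ZdEdge d) => (if e ∈ X then (X.card : ℝ) * ∑ y ∈ X, lipV X y else 0) := fun e =>
    Summable.of_nonneg_of_le (hnn e) (hcmp e) (hLs4 e)
  have hL2 : ∀ e, ∑' X : Finset (ZdEdge d), (if e ∈ X then (X.card : ℝ) * ∑ y ∈ X, lipV X y else 0) ≤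
      4 * (|κ| * (8 * ((d : ℝ) - 1) * Real.sqrt N)) := fun e =>
    (Summable.tsum_le_tsum (hcmp e) (hL2s e) (hLs4 e)).trans (by rw [tsum_mul_left]; exact mul_le_mul_of_nonneg_left (hL e) (by norm_num))
  obtain ⟨h1, h2⟩ := hasDerivAt_tsum_cov_direction_S hd hN hc hv hb hP hVB ht hρ hW hV haV hΛV hs₀ ha' hΛ' hlip hLs hL hL2s hL2 hV.continuous
    hV.dependsOn hlip hLs hL hL2s hL2 hν' hFm hFdep hMF hδF
  exact ⟨h1, h2, contDiffOn_two_integral_direction_S hd hN hc hv hb hP hVB ht hρ hW hV haV hΛV hs₀ ha' hΛ' hlip hLs hL hL2s hL2 hν' hFm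
    hFdep hMF hδF⟩

end Coupling

/-! ### `SU(2)`, `ℤ⁴`, hypothesis-free -/

/-- **`SU(2)`, `ℤ⁴` — THE STATE IS `C²` ALONG EVERY DIRECTION OF FINITE SIZE-WEIGHTED LOAD OF THE OPEN WEIGHTED BALL.**  `0 < t`, `0 < s₀`,
`6|β_W| e^{a'} e^{t} + e^{a'/2} √(2/3) Λ' < 1`, `W ∈ MemBallZdS a Λ t`, `V ∈ MemBallZdS a_V Λ_V t` with Frobenius-Lipschitz witnesses of total load
`≤ L` and size-weighted load `≤ L₂` through every link, `a + s₀ a_V ≤ a'`, `Λ + s₀ Λ_V ≤ Λ'` (bare coupling `β_W/2`): for every selection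
`ν(s) ∈ 𝒢(W + sV)` on `|s| ≤ s₀` and every Lipschitz cylinder `F`: (i) `d/ds Σ'_X cov_{ν(s)}(F, V_X) = −Σ'_{(X,Y)} u₃^{ν(s)}(F; V_X; V_Y)` at every
`|s| < s₀`, and (ii) `s ↦ ∫ F dν(s)` is `ContDiffOn ℝ 2` on `(−s₀, s₀)`. -/
theorem su2_contDiffOn_two_integral_direction_dim4 {βW a' Λ' t a Λ aV ΛV s₀ : ℝ} (ht : 0 < t) (hs₀ : 0 < s₀)
    (hρ : 6 * |βW| * (exp a' * exp t) + exp (a' / 2) * Real.sqrt (2 / 3) * Λ' < 1)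
    {W V : Potential (ZdEdge 4) (Matrix.specialUnitaryGroup (Fin 2) ℂ)} (hW : MemBallZdS a Λ t W) (hV : MemBallZdS aV ΛV t V)
    (haV : 0 ≤ aV) (hΛV : 0 ≤ ΛV) (ha' : a + s₀ * aV ≤ a') (hΛ' : Λ + s₀ * ΛV ≤ Λ')
    {lipV : Finset (ZdEdge 4) → ZdEdge 4 → ℝ} (hlipV : ∀ X, IsLipBound suFrobDist (V X) (lipV X)) {L L₂ : ℝ}
    (hLs : ∀ e, Summable fun X : Finset (ZdEdge 4) => (if e ∈ X then ∑ y ∈ X, lipV X y else 0))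
    (hL : ∀ e, ∑' X : Finset (ZdEdge 4), (if e ∈ X then ∑ y ∈ X, lipV X y else 0) ≤ L)
    (hL2s : ∀ e, Summable fun X : Finset (ZdEdge 4) => (if e ∈ X then X.card * ∑ y ∈ X, lipV X y else 0))
    (hL2 : ∀ e, ∑' X : Finset (ZdEdge 4), (if e ∈ X then X.card * ∑ y ∈ X, lipV X y else 0) ≤ L₂)
    {ν : ℝ → Measure (LGConfig 4 (Matrix.specialUnitaryGroup (Fin 2) ℂ))}
    (hν : ∀ s ∈ Set.Icc (-s₀) s₀, ν s ∈ perturbedGibbsMeasuresS (d := 4) (fundamentalRep (Fin 2)) (2 * (βW / 4)) (W + s • V))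
    {F : LGConfig 4 (Matrix.specialUnitaryGroup (Fin 2) ℂ) → ℝ} {ΛF : Finset (ZdEdge 4)} {KF : ℝ≥0}
    (hF : IsLipschitzCylinder (fundamentalRep (Fin 2)) F ΛF KF) :
    (∀ s ∈ Set.Ioo (-s₀) s₀, HasDerivAt (fun s => ∑' X : Finset (ZdEdge 4), cov[F, V X; ν s])
      (-(∑' p : Finset (ZdEdge 4) × Finset (ZdEdge 4), (cov[fun U => F U * V p.1 U, V p.2; ν s] -
        (∫ U, F U ∂(ν s)) * cov[V p.1, V p.2; ν s] - (∫ U, V p.1 U ∂(ν s)) * cov[F, V p.2; ν s]))) s) ∧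
      ContDiffOn ℝ 2 (fun s => ∫ U, F U ∂(ν s)) (Set.Ioo (-s₀) s₀) := by
  have hc : (0 : ℝ) ≤ 2 / 3 := by norm_num
  have hP : ∀ B : Matrix (Fin 2) (Fin 2) ℂ, matrixOpNorm B ≤ |βW / 4| * (2 * (((4 : ℕ) : ℝ) - 1)) →
      ∀ (ψ : Matrix.specialUnitaryGroup (Fin 2) ℂ → ℝ) (M : ℝ), 0 ≤ M →
        (∀ x y, |ψ x - ψ y| ≤ M * suFrobDist x y) →
        Var[ψ; (haarProbability (Matrix.specialUnitaryGroup (Fin 2) ℂ)).tilted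
          fun g => ((2 : ℕ) : ℝ) * ((g : Matrix (Fin 2) (Fin 2) ℂ) * B).trace.re] ≤ 2 / 3 * M ^ 2 :=
    fun B hB ψ M hM hψ => oneLinkPoincareSUN_two_sharp _ B hB ψ M hM hψ
  have hVB := linVariance_of_poincare (N := 2) hP
  have hv : (0 : ℝ) ≤ 2 / 3 * ((2 : ℕ) : ℝ) ^ 2 := by norm_num
  have hsq : Real.sqrt (2 / 3 * (2 / 3 * ((2 : ℕ) : ℝ) ^ 2)) = 4 / 3 := by
    rw [show (2 / 3 * (2 / 3 * ((2 : ℕ) : ℝ) ^ 2) : ℝ) = (4 / 3) ^ 2 by norm_num, Real.sqrt_sq (by norm_num)]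
  have hρ' : 6 * (((4 : ℕ) : ℝ) - 1) * |βW / 4| * (exp a' * exp t * Real.sqrt (2 / 3 * (2 / 3 * ((2 : ℕ) : ℝ) ^ 2))) +
      exp (a' / 2) * Real.sqrt (2 / 3) * Λ' < 1 := by
    rw [hsq, abs_div, abs_of_pos (by norm_num : (0 : ℝ) < 4)]
    have : 6 * (((4 : ℕ) : ℝ) - 1) * (|βW| / 4) * (exp a' * exp t * (4 / 3)) = 6 * |βW| * (exp a' * exp t) := by norm_num; ring
    rw [this]; exact hρ
  have hν' : ∀ s ∈ Set.Icc (-s₀) s₀, ν s ∈ perturbedGibbsMeasuresS (d := 4) (fundamentalRep (Fin 2)) ((2 : ℕ) * (βW / 4)) (W + s • V) :=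
    fun s hs => by simpa using hν s hs
  have hA : ∀ a b : Matrix.specialUnitaryGroup (Fin 2) ℂ, dist (suEntries a) (suEntries b) ≤ 1 * suFrobDist a b :=
    fun a b => by rw [one_mul]; exact dist_suEntries_le_suFrobDist a b
  have key := hasDerivAt_tsum_cov_direction_S (N := 2) (d := 4) (by norm_num) (by norm_num) hc hv le_rfl hP hVB ht hρ' hW hV haV hΛV hs₀
    ha' hΛ' hlipV hLs hL hL2s hL2 hV.continuous hV.dependsOn hlipV hLs hL hL2s hL2 hν' hF.measurable hF.dependsOn hF.abs_le
    (hF.isLipBound zero_le_one hA)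
  exact ⟨key.1, contDiffOn_two_integral_direction_S (N := 2) (d := 4) (by norm_num) (by norm_num) hc hv le_rfl hP hVB ht hρ' hW hV haV hΛV
    hs₀ ha' hΛ' hlipV hLs hL hL2s hL2 hν' hF.measurable hF.dependsOn hF.abs_le (hF.isLipBound zero_le_one hA)⟩

/-- **`SU(2)`, `ℤ⁴` — EVERY MEMBER OF THE WEIGHTED BALL IS `C²` IN THE WILSON COUPLING `β_W`.**  `0 < t`, `0 < s₀`,
`6|β_W| e^{a'} e^{t} + e^{a'/2} √(2/3) Λ' < 1`, `W ∈ MemBallZdS a Λ t`, `a + 12 s₀ ≤ a'`, `Λ + 12√2 e^{t} s₀ ≤ Λ'` (bare coupling `β_W/2`, direction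
`½·wilsonDirection`): for every selection `ν(s) ∈ 𝒢_{β_W + s}(W)` on `|s| ≤ s₀` and every Lipschitz cylinder `F`, `s ↦ ∫ F dν(s)` is `ContDiffOn ℝ 2`
on `(−s₀, s₀)` (first derivative `−Σ'_X cov(F, (½·wD)_X)` by `su2_hasDerivAt_integral_coupling_dim4`, second derivative the continuous double
plaquette-cumulant series). -/
theorem su2_contDiffOn_two_integral_coupling_dim4 {βW a' Λ' t a Λ s₀ : ℝ} (ht : 0 < t) (hs₀ : 0 < s₀)
    (hρ : 6 * |βW| * (exp a' * exp t) + exp (a' / 2) * Real.sqrt (2 / 3) * Λ' < 1)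
    {W : Potential (ZdEdge 4) (Matrix.specialUnitaryGroup (Fin 2) ℂ)} (hW : MemBallZdS a Λ t W)
    (ha' : a + 12 * s₀ ≤ a') (hΛ' : Λ + 12 * Real.sqrt 2 * exp t * s₀ ≤ Λ')
    {ν : ℝ → Measure (LGConfig 4 (Matrix.specialUnitaryGroup (Fin 2) ℂ))}
    (hν : ∀ s ∈ Set.Icc (-s₀) s₀, ν s ∈ perturbedGibbsMeasuresS (d := 4) (fundamentalRep (Fin 2)) (2 * ((βW + s) / 4)) W)
    {F : LGConfig 4 (Matrix.specialUnitaryGroup (Fin 2) ℂ) → ℝ} {ΛF : Finset (ZdEdge 4)} {KF : ℝ≥0}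
    (hF : IsLipschitzCylinder (fundamentalRep (Fin 2)) F ΛF KF) :
    ContDiffOn ℝ 2 (fun s => ∫ U, F U ∂(ν s)) (Set.Ioo (-s₀) s₀) := by
  have hc : (0 : ℝ) ≤ 2 / 3 := by norm_num
  have hP : ∀ B : Matrix (Fin 2) (Fin 2) ℂ, matrixOpNorm B ≤ |βW / 4| * (2 * (((4 : ℕ) : ℝ) - 1)) →
      ∀ (ψ : Matrix.specialUnitaryGroup (Fin 2) ℂ → ℝ) (M : ℝ), 0 ≤ M →
        (∀ x y, |ψ x - ψ y| ≤ M * suFrobDist x y) →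
        Var[ψ; (haarProbability (Matrix.specialUnitaryGroup (Fin 2) ℂ)).tilted
          fun g => ((2 : ℕ) : ℝ) * ((g : Matrix (Fin 2) (Fin 2) ℂ) * B).trace.re] ≤ 2 / 3 * M ^ 2 :=
    fun B hB ψ M hM hψ => oneLinkPoincareSUN_two_sharp _ B hB ψ M hM hψ
  have hVB := linVariance_of_poincare (N := 2) hP
  have hv : (0 : ℝ) ≤ 2 / 3 * ((2 : ℕ) : ℝ) ^ 2 := by norm_num
  have hsq : Real.sqrt (2 / 3 * (2 / 3 * ((2 : ℕ) : ℝ) ^ 2)) = 4 / 3 := by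
    rw [show (2 / 3 * (2 / 3 * ((2 : ℕ) : ℝ) ^ 2) : ℝ) = (4 / 3) ^ 2 by norm_num, Real.sqrt_sq (by norm_num)]
  have hρ' : 6 * (((4 : ℕ) : ℝ) - 1) * |βW / 4| * (exp a' * exp t * Real.sqrt (2 / 3 * (2 / 3 * ((2 : ℕ) : ℝ) ^ 2))) +
      exp (a' / 2) * Real.sqrt (2 / 3) * Λ' < 1 := by
    rw [hsq, abs_div, abs_of_pos (by norm_num : (0 : ℝ) < 4)]
    have : 6 * (((4 : ℕ) : ℝ) - 1) * (|βW| / 4) * (exp a' * exp t * (4 / 3)) = 6 * |βW| * (exp a' * exp t) := by norm_num; ring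
    rw [this]; exact hρ
  have hν' : ∀ s ∈ Set.Icc (-s₀) s₀, ν s ∈ perturbedGibbsMeasuresS (d := 4) (fundamentalRep (Fin 2)) ((2 : ℕ) * (βW / 4) + s * (1 / 2)) W :=
    fun s hs => by
      have h := hν s hs
      have he : (2 : ℝ) * ((βW + s) / 4) = ((2 : ℕ) : ℝ) * (βW / 4) + s * (1 / 2) := by push_cast; ring
      rwa [he] at h
  have hA : ∀ a b : Matrix.specialUnitaryGroup (Fin 2) ℂ, dist (suEntries a) (suEntries b) ≤ 1 * suFrobDist a b :=
    fun a b => by rw [one_mul]; exact dist_suEntries_le_suFrobDist a b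
  have h2 : Real.sqrt ((2 : ℕ) : ℝ) = Real.sqrt 2 := by norm_num
  have ha'' : a + s₀ * (|(1 : ℝ) / 2| * (4 * (((4 : ℕ) : ℝ) - 1) * ((2 : ℕ) : ℝ))) ≤ a' := by
    rw [abs_of_pos (by norm_num : (0 : ℝ) < 1 / 2)]; norm_num; linarith
  have hΛ'' : Λ + s₀ * (|(1 : ℝ) / 2| * (exp t * (8 * (((4 : ℕ) : ℝ) - 1) * Real.sqrt ((2 : ℕ) : ℝ)))) ≤ Λ' := by
    rw [abs_of_pos (by norm_num : (0 : ℝ) < 1 / 2), h2]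
    have : s₀ * (1 / 2 * (exp t * (8 * (((4 : ℕ) : ℝ) - 1) * Real.sqrt 2))) = 12 * Real.sqrt 2 * exp t * s₀ := by norm_num; ring
    rw [this]; exact hΛ'
  exact (contDiffOn_two_integral_coupling_S (N := 2) (d := 4) (by norm_num) (by norm_num) hc hv le_rfl hP hVB ht hρ' hW hs₀ ha'' hΛ'' hν'
    hF.measurable hF.dependsOn hF.abs_le (hF.isLipBound zero_le_one hA)).2.2

end Summit.Ventures.YMGap.RobustBall

end
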